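import Summits.Ventures.CertifiedManyBodySolver.Certificates.HubbardSquare_tpp_hfCaps_n3o4_boxp3
import Summits.Ventures.CertifiedManyBodySolver.Observables.PhaseSeparationExclusionBox
import Literature.MathematicalPhysics.QuantumLattice.HubbardTTPrimePhaseCoexistenceExclusion
import Literature.MathematicalPhysics.QuantumLattice.HubbardNNNHoppingEnergyDensityParticleHole
import Literature.MathematicalPhysics.QuantumLattice.HubbardFermiSeaCellRows
import Literature.MathematicalPhysics.QuantumLattice.HubbardFermiSeaTangentRowsMirrorTPrimeQuarter
import HarnessLib
import HarnessLib.Audit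

/-!
# Ventures/CertifiedManyBodySolver — Observables/PhaseSeparationExclusionTPrimeCellsWeakFreeElectron.lean (PREMISE-FREE weak-coupling competing-order sentences on the ELECTRON-DOPED side of the cuprate `t′`-range, via particle–hole symmetry at general `t′`)

HONEST FRAMING: first certified bounds; not a superconductivity verdict. CLASS = DERIVED / CONTEXT + KERNEL: EVERY theorem here is PREMISE-FREE — kernel
Fermi-sea floors × kernel Hartree–Fock caps × PROVED laws, NO claim node. CONTROL class (weak coupling); no number of record. Seat hubbard-box-p3 g25
(`prover-hubbard-box-p3-g25-0`, S2 «t′-direction / joint cells»); generator `work/psweak/emit_tprime_electron.py`. Companion of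
`PhaseSeparationExclusionTPrimeCellsWeakFree.lean` (p662839: hole side at `t′ ∈ [−3/10, −1/5]`).

THE POINT. The particle–hole image of `(t′, n)` is `(−t′, 2 − n)` (`energyDensityTT'_particleHole`: `e(1,t′,U,n) = e(1,−t′,U,2−n) + U(n−1)`,
[Lieb–Wu 2003, eq. (3)] with the NNN sign flip): electron-doped cuprates (`t′ < 0`, `n > 1`) are the images of the HOLE-side model at `t′ > 0`. §0 types the
general-`t′` mirror law (`psT_strict_mirror_thresholds`, `psT_thresholds_mirror_not_groundState_mix_of_cap_lt`; the tree's `ps_strict_mirror_thresholds` is the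
`t′ = 0` case); §1 the premise-free hole-side sentences on the MIRROR columns `t′ ∈ {+3/10, +1/4, +1/5}` — inputs: the NEW kernel Fermi-sea point rows at quarter
filling `fermiSeaCellRow_tPrime_{three_div_ten,one_div_four,one_div_five}_density_one_div_two` (`HubbardFermiSeaTangentRowsMirrorTPrimeQuarter`, p663662), the
half-filling rows at `−t′` carried by evenness (`energyDensityTT'_particleHole_one`), and the NEW kernel Hartree–Fock caps `hfCap_tpp*_n3o4` / affine `hfCapAff_tpp1o5_p3o10_n3o4`
(`Certificates/HubbardSquare_tpp_hfCaps_n3o4_boxp3`, p663896); §2–§3 their ELECTRON-SIDE images at `t′ ∈ {−3/10, −1/4, −1/5}` and on the cell `[−3/10, −1/5] × [0, 39/50]`.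
The `U = 0` convexity defects on the mirror columns (`0.113–0.123`) are TWICE the hole-side ones at `t′ < 0` (`0.049–0.058`, p662839), so the electron-side
`U`-reach is `≈ 0.8·t` against `≈ 0.35·t`.

WHAT IT SAYS (`t = 1`; «`(n₁ | n₃)` excluded at `(t′, U)`» as in the companion; margin `M = ½·floor(1/2) + ½·floor(1) − cap(3/4)` on the hole side, affine in `U`):
* hole side `(1/2 | 1)` at `t′ = +3/10` and ELECTRON side `(1 | 3/2)` at `t′ = −3/10`: `U ∈ [0, 17/20]` (`M(0) = 0.1226226256`, `M(17/20) ≥ 0.0030913756`, zero `≈ 0.8720`);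
* hole side `(1/2 | 1)` at `t′ = +1/4` and ELECTRON side `(1 | 3/2)` at `t′ = −1/4`: `U ∈ [0, 4/5]` (`M(0) = 0.1178063336`, `M(4/5) ≥ 0.0053063336`, zero `≈ 0.8377`);
* hole side `(1/2 | 1)` at `t′ = +1/5` and ELECTRON side `(1 | 3/2)` at `t′ = −1/5`: `U ∈ [0, 4/5]` (`M(0) = 0.1129173318`, `M(4/5) ≥ 0.0004173318`, zero `≈ 0.8030`);
* ELECTRON side `(1 | 3/2)` on the CELL `t′ ∈ [−3/10, −1/5] × U ∈ [0, 39/50]` (hole-side mirror cell `[1/5, 3/10]`: `t′`-chord floors, affine cap; corner margins at `U = 0`: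
  `0.1221463642` @ `∓3/10`, `0.1127464762` @ `∓1/5`; at `U = 39/50`: `≥ 0.0030589762`).
READING: at the electron-doped cuprate `t′`-range `[−0.3, −0.2]` and weak coupling `U ≤ 0.78·t`, no translation-invariant ground state of the one-band `t–t′–U`
model is a macroscopic mixture of a phase at or below half filling and a phase of density `≥ 3/2` — certified with NO producer input.
WHAT THIS IS NOT: a certificate; a CERTIFIED row; a statement at larger `U`, about stripes / finite-period states, `T > 0`, or any material (NCCO etc.);
a superconductivity sentence.
[cite: EmeryKivelsonLin1990, pp. 475–476] [cite: Israel1979, Thm. I.2.4] [cite: LiebWuPhysicaA2003, §1 eq. (3)] [cite: BachLiebSolovej1994, eq. (2c.36)] [cite: LiebLoss1993, §8, Theorem 8.2] [cite: Ruelle1969, §3.3]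
-/

noncomputable section

namespace Summit.Ventures.CertifiedManyBodySolver.Observables

open Matrix Finset Filter Topology Set Literature.MathematicalPhysics.QuantumLattice
open Literature.Probability.LatticeModels HubbardWave0 ThermodynamicLimit InfVolFermionState
open Summit.Ventures.CertifiedManyBodySolver.Certificates
open scoped ComplexOrder

/-! ## §0 Particle–hole mirror at general `t′` -/

/-- **Mirror of a strict defect at general `t′`** (`t = 1`, `U ≥ 0`, `s + s' = 0`): for `0 < n₁ < n₃ < 2`, weights `a, b ≥ 0`, `a + b = 1`, `m = a·n₁ + b·n₃`,
the defect `e(1,s,U,m) < a·e(1,s,U,n₁) + b·e(1,s,U,n₃)` at `t′ = s` implies `e(1,s',U,2−m) < b·e(1,s',U,2−n₃) + a·e(1,s',U,2−n₁)` at `t′ = s' = −s`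
(`e(1,s,U,n) = e(1,−s,U,2−n) + U(n−1)` shifts `e` by an affine function of `n`). The `t′ = 0` case is `ps_strict_mirror_thresholds`.
[cite: LiebWuPhysicaA2003, §1 eq. (3)] -/
theorem psT_strict_mirror_thresholds (s s' : ℝ) (hss : s + s' = 0) {U : ℝ} (hU : 0 ≤ U) {n₁ n₃ a b m : ℝ} (hn₁ : 0 < n₁)
    (hn : n₁ < n₃) (hn₃ : n₃ < 2) (ha : 0 ≤ a) (hb : 0 ≤ b) (hab : a + b = 1) (hm : a * n₁ + b * n₃ = m)
    (hstrict : energyDensityTT' 1 s U m < a * energyDensityTT' 1 s U n₁ + b * energyDensityTT' 1 s U n₃) :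
    energyDensityTT' 1 s' U (2 - m) < b * energyDensityTT' 1 s' U (2 - n₃) + a * energyDensityTT' 1 s' U (2 - n₁) := by
  have hm0 : 0 < m := by rw [← hm]; nlinarith
  have hm2 : m < 2 := by rw [← hm]; nlinarith
  have hs' : -s = s' := by linarith
  have e1 : energyDensityTT' 1 s U n₁ = energyDensityTT' 1 s' U (2 - n₁) + U * (n₁ - 1) := by
    have h0 := energyDensityTT'_particleHole 1 s (U := U) hU (n := n₁) hn₁ (by linarith)
    rw [hs'] at h0
    exact h0
  have e3 : energyDensityTT' 1 s U n₃ = energyDensityTT' 1 s' U (2 - n₃) + U * (n₃ - 1) := by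
    have h0 := energyDensityTT'_particleHole 1 s (U := U) hU (n := n₃) (by linarith) hn₃
    rw [hs'] at h0
    exact h0
  have em : energyDensityTT' 1 s U m = energyDensityTT' 1 s' U (2 - m) + U * (m - 1) := by
    have h0 := energyDensityTT'_particleHole 1 s (U := U) hU (n := m) hm0 hm2
    rw [hs'] at h0
    exact h0
  rw [e1, e3, em] at hstrict
  have key : U * (m - 1) = a * (U * (n₁ - 1)) + b * (U * (n₃ - 1)) := by
    rw [← hm]
    have hb' : b = 1 - a := by linarith
    rw [hb']; ring
  rw [key] at hstrict
  linarith

/-- **The ELECTRON-side `(ρ₁ ≤ p | ρ₃ ≥ q)` sentence at `t′ = s' = −s` from a HOLE-side transported triple at `t′ = s`** (`t = 1`, `U ≥ 0`; `0 < n₁ < n₃ < 2`,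
`p = 2 − n₃`, `q = 2 − n₁`): floors `f₁ ≤ e(1,s,U,n₁)`, `f₃ ≤ e(1,s,U,n₃)`, a cap `e(1,s,U,m) ≤ c` at `m = a·n₁ + b·n₃` with `c < a f₁ + b f₃` ⇒ at `t′ = s'` no mixture
`λω₁ + (1−λ)ω₃` (`0 < λ < 1`) of translation-invariant states with `0 < ρ(ω₁) ≤ p`, `q ≤ ρ(ω₃) < 2` is a ground state at its density (§0 mirror +
super-segment law `IsTranslationInvariant.energyDensityTT'_lt_meanEnergy_mix_of_strict_at_of_le`). [cite: Israel1979, Thm. I.2.4] [cite: LiebWuPhysicaA2003, §1 eq. (3)] -/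
theorem psT_thresholds_mirror_not_groundState_mix_of_cap_lt (s s' : ℝ) (hss : s + s' = 0) {U : ℝ} (hU : 0 ≤ U)
    {n₁ n₃ p q a b m c f₁ f₃ : ℝ} (hn₁ : 0 < n₁) (hn : n₁ < n₃) (hn₃ : n₃ < 2) (hp : p + n₃ = 2) (hq : q + n₁ = 2)
    (ha : 0 ≤ a) (hb : 0 ≤ b) (hab : a + b = 1) (hm : a * n₁ + b * n₃ = m) (hcap : energyDensityTT' 1 s U m ≤ c)
    (hf₁ : f₁ ≤ energyDensityTT' 1 s U n₁) (hf₃ : f₃ ≤ energyDensityTT' 1 s U n₃) (hc : c < a * f₁ + b * f₃)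
    {ω₁ ω₃ : InfVolFermionState 2} (h₁ : ω₁.IsTranslationInvariant) (h₃ : ω₃.IsTranslationInvariant)
    (hρ₁ : 0 < ω₁.density) (hρ₁' : ω₁.density ≤ p) (hρ₃ : q ≤ ω₃.density) (hρ₃' : ω₃.density < 2)
    {lam : ℝ} (hl0 : 0 < lam) (hl1 : lam < 1) :
    energyDensityTT' 1 s' U (InfVolFermionState.mix lam hl0.le hl1.le ω₁ ω₃).density <
      (InfVolFermionState.mix lam hl0.le hl1.le ω₁ ω₃).meanEnergy (hubbardTTPrimeFermionInteraction 1 s' U) 1 := by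
  have hstrict : energyDensityTT' 1 s U m < a * energyDensityTT' 1 s U n₁ + b * energyDensityTT' 1 s U n₃ := by
    nlinarith [mul_le_mul_of_nonneg_left hf₁ ha, mul_le_mul_of_nonneg_left hf₃ hb]
  have hmir := psT_strict_mirror_thresholds s s' hss hU hn₁ hn hn₃ ha hb hab hm hstrict
  have hp' : (2 : ℝ) - n₃ = p := by linarith
  have hq' : (2 : ℝ) - n₁ = q := by linarith
  have hm2 : (2 : ℝ) - m = b * p + a * q := by rw [← hp', ← hq', ← hm]; linarith [hab]
  rw [hm2, hp', hq'] at hmir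
  exact h₁.energyDensityTT'_lt_meanEnergy_mix_of_strict_at_of_le 1 s' hU h₃ hρ₁ hρ₃' hρ₁' (by linarith) hρ₃ hb ha
    (by linarith) hmir hl0 hl1

/-- Local copy of the general-`t′` HOLE-side wrapper (same statement as `psT_thresholds_not_groundState_mix_of_cap_lt` of the companion file, kept private
to avoid a cross-file name clash). [cite: Israel1979, Thm. I.2.4] -/
private theorem psT_thresholds_of_cap_lt' (s : ℝ) {U : ℝ} (hU : 0 ≤ U) {n₁ n₃ a b m c f₁ f₃ : ℝ} (hn : n₁ < n₃)
    (ha : 0 ≤ a) (hb : 0 ≤ b) (hab : a + b = 1) (hm : a * n₁ + b * n₃ = m) (hcap : energyDensityTT' 1 s U m ≤ c)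
    (hf₁ : f₁ ≤ energyDensityTT' 1 s U n₁) (hf₃ : f₃ ≤ energyDensityTT' 1 s U n₃) (hc : c < a * f₁ + b * f₃)
    {ω₁ ω₃ : InfVolFermionState 2} (h₁ : ω₁.IsTranslationInvariant) (h₃ : ω₃.IsTranslationInvariant)
    (hρ₁ : 0 < ω₁.density) (hρ₁' : ω₁.density ≤ n₁) (hρ₃ : n₃ ≤ ω₃.density) (hρ₃' : ω₃.density < 2)
    {lam : ℝ} (hl0 : 0 < lam) (hl1 : lam < 1) :
    energyDensityTT' 1 s U (InfVolFermionState.mix lam hl0.le hl1.le ω₁ ω₃).density <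
      (InfVolFermionState.mix lam hl0.le hl1.le ω₁ ω₃).meanEnergy (hubbardTTPrimeFermionInteraction 1 s U) 1 := by
  have hcap' : energyDensityTT' 1 s U (a * n₁ + b * n₃) ≤ c := by rw [hm]; exact hcap
  exact h₁.energyDensityTT'_lt_meanEnergy_mix_of_cap_lt_floors_of_le 1 s hU h₃ hρ₁ hρ₃' hρ₁' hn hρ₃ ha hb hab
    hcap' hf₁ hf₃ hc hl0 hl1

/-! ## §1 Hole side on the mirror columns `t′ ∈ {+3/10, +1/4, +1/5}` (premise-free) -/

/-- **`(1/2 | 1)` excluded at `t′ = +3/10` for every `U ∈ [0, 17/20]`** (`t = 1`; PREMISE-FREE; triple `(1/2, 3/4, 1)`, weights `(1/2, 1/2)`; floors = kernel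
Fermi-sea rows `fermiSeaCellRow_tPrime_three_div_ten_density_one_div_two` (NEW, quarter filling) and `fermiSeaCellRow_tPrime_neg_three_div_ten_density_one` carried to `+3/10` by evenness at half filling
(`energyDensityTT'_particleHole_one`); cap = kernel Hartree–Fock row `hfCap_tpp3o10_n3o4` (`-1.7302184194… + 9U/64`); NO claim node):
`M(U) = 0.1226226256 − 9U/64`, `M(17/20) ≥ 0.0030913756` (zero at `U ≈ 0.8720`).
[cite: EmeryKivelsonLin1990, pp. 475–476] [cite: Israel1979, Thm. I.2.4] [cite: BachLiebSolovej1994, eq. (2c.36)] [cite: LiebLoss1993, §8, Theorem 8.2] -/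
theorem psTW_half_one_tpp3o10_not_groundState_mix {U : ℝ} (hU : U ∈ Set.Icc (0 : ℝ) (17 / 20 : ℝ))
    {ω₁ ω₃ : InfVolFermionState 2} (h₁ : ω₁.IsTranslationInvariant) (h₃ : ω₃.IsTranslationInvariant)
    (hρ₁ : 0 < ω₁.density) (hρ₁' : ω₁.density ≤ (1 / 2)) (hρ₃ : 1 ≤ ω₃.density) (hρ₃' : ω₃.density < 2)
    {lam : ℝ} (hl0 : 0 < lam) (hl1 : lam < 1) :
    energyDensityTT' 1 (3 / 10) U (InfVolFermionState.mix lam hl0.le hl1.le ω₁ ω₃).density <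
      (InfVolFermionState.mix lam hl0.le hl1.le ω₁ ω₃).meanEnergy (hubbardTTPrimeFermionInteraction 1 (3 / 10) U) 1 := by
  obtain ⟨hlo, hhi⟩ := hU
  have hU0 : (0 : ℝ) ≤ U := hlo
  have k12tpp3o10 : ((-15505264679/10000000000 : ℚ) : ℝ) ≤ energyDensityTT' 1 (3 / 10) U (1 / 2) := by
    have h0 := fermiSeaCellRow_tPrime_three_div_ten_density_one_div_two (U := U) hU0
    have e0 : ((-15505264679/10000000000 : ℚ) : ℝ) = (-1.5505264679 : ℝ) := by norm_num
    rw [e0]; norm_num at h0 ⊢; linarith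
  have k1tpp3o10 : ((-4161662799/2500000000 : ℚ) : ℝ) ≤ energyDensityTT' 1 (3 / 10) U 1 := by
    have h0 := fermiSeaCellRow_tPrime_neg_three_div_ten_density_one (U := U) hU0
    have he := energyDensityTT'_particleHole_one 1 (-3 / 10 : ℝ) hU0
    rw [show (-(-3 / 10 : ℝ)) = 3 / 10 by norm_num] at he
    have e0 : ((-4161662799/2500000000 : ℚ) : ℝ) = (-1.6646651196 : ℝ) := by norm_num
    rw [he, e0]; norm_num at h0 ⊢; linarith
  have kcap : energyDensityTT' 1 (3 / 10) U (3 / 4) ≤ ((-8651092097/5000000000 : ℚ) : ℝ) + U * ((3 / 4 : ℝ) / 2) ^ 2 := hfCap_tpp3o10_n3o4 (U := U) hU0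
  refine psT_thresholds_of_cap_lt' (3 / 10) hU0 (n₁ := (1 / 2)) (n₃ := 1) (a := (1 / 2)) (b := (1 / 2))
    (by norm_num) (by norm_num) (by norm_num) (by norm_num) (by norm_num) kcap k12tpp3o10 k1tpp3o10 ?_ h₁ h₃ hρ₁ hρ₁' hρ₃ hρ₃' hl0 hl1
  push_cast
  nlinarith [hlo, hhi]

/-- **`(1/2 | 1)` excluded at `t′ = +1/4` for every `U ∈ [0, 4/5]`** (`t = 1`; PREMISE-FREE; triple `(1/2, 3/4, 1)`, weights `(1/2, 1/2)`; floors = kernel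
Fermi-sea rows `fermiSeaCellRow_tPrime_one_div_four_density_one_div_two` (NEW, quarter filling) and `fermiSeaCellRow_tPrime_neg_one_div_four_density_one` carried to `+1/4` by evenness at half filling
(`energyDensityTT'_particleHole_one`); cap = kernel Hartree–Fock row `hfCap_tpp1o4_n3o4` (`-1.6999815874… + 9U/64`); NO claim node):
`M(U) = 0.1178063336 − 9U/64`, `M(4/5) ≥ 0.0053063336` (zero at `U ≈ 0.8377`).
[cite: EmeryKivelsonLin1990, pp. 475–476] [cite: Israel1979, Thm. I.2.4] [cite: BachLiebSolovej1994, eq. (2c.36)] [cite: LiebLoss1993, §8, Theorem 8.2] -/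
theorem psTW_half_one_tpp1o4_not_groundState_mix {U : ℝ} (hU : U ∈ Set.Icc (0 : ℝ) (4 / 5 : ℝ))
    {ω₁ ω₃ : InfVolFermionState 2} (h₁ : ω₁.IsTranslationInvariant) (h₃ : ω₃.IsTranslationInvariant)
    (hρ₁ : 0 < ω₁.density) (hρ₁' : ω₁.density ≤ (1 / 2)) (hρ₃ : 1 ≤ ω₃.density) (hρ₃' : ω₃.density < 2)
    {lam : ℝ} (hl0 : 0 < lam) (hl1 : lam < 1) :
    energyDensityTT' 1 (1 / 4) U (InfVolFermionState.mix lam hl0.le hl1.le ω₁ ω₃).density <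
      (InfVolFermionState.mix lam hl0.le hl1.le ω₁ ω₃).meanEnergy (hubbardTTPrimeFermionInteraction 1 (1 / 4) U) 1 := by
  obtain ⟨hlo, hhi⟩ := hU
  have hU0 : (0 : ℝ) ≤ U := hlo
  have k12tpp1o4 : ((-3777207301/2500000000 : ℚ) : ℝ) ≤ energyDensityTT' 1 (1 / 4) U (1 / 2) := by
    have h0 := fermiSeaCellRow_tPrime_one_div_four_density_one_div_two (U := U) hU0
    have e0 : ((-3777207301/2500000000 : ℚ) : ℝ) = (-1.5108829204 : ℝ) := by norm_num
    rw [e0]; norm_num at h0 ⊢; linarith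
  have k1tpp1o4 : ((-16534675871/10000000000 : ℚ) : ℝ) ≤ energyDensityTT' 1 (1 / 4) U 1 := by
    have h0 := fermiSeaCellRow_tPrime_neg_one_div_four_density_one (U := U) hU0
    have he := energyDensityTT'_particleHole_one 1 (-1 / 4 : ℝ) hU0
    rw [show (-(-1 / 4 : ℝ)) = 1 / 4 by norm_num] at he
    have e0 : ((-16534675871/10000000000 : ℚ) : ℝ) = (-1.6534675871 : ℝ) := by norm_num
    rw [he, e0]; norm_num at h0 ⊢; linarith
  have kcap : energyDensityTT' 1 (1 / 4) U (3 / 4) ≤ ((-8499907937/5000000000 : ℚ) : ℝ) + U * ((3 / 4 : ℝ) / 2) ^ 2 := hfCap_tpp1o4_n3o4 (U := U) hU0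
  refine psT_thresholds_of_cap_lt' (1 / 4) hU0 (n₁ := (1 / 2)) (n₃ := 1) (a := (1 / 2)) (b := (1 / 2))
    (by norm_num) (by norm_num) (by norm_num) (by norm_num) (by norm_num) kcap k12tpp1o4 k1tpp1o4 ?_ h₁ h₃ hρ₁ hρ₁' hρ₃ hρ₃' hl0 hl1
  push_cast
  nlinarith [hlo, hhi]

/-- **`(1/2 | 1)` excluded at `t′ = +1/5` for every `U ∈ [0, 4/5]`** (`t = 1`; PREMISE-FREE; triple `(1/2, 3/4, 1)`, weights `(1/2, 1/2)`; floors = kernel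
Fermi-sea rows `fermiSeaCellRow_tPrime_one_div_five_density_one_div_two` (NEW, quarter filling) and `fermiSeaCellRow_tPrime_neg_one_div_five_density_one` carried to `+1/5` by evenness at half filling
(`energyDensityTT'_particleHole_one`); cap = kernel Hartree–Fock row `hfCap_tpp1o5_n3o4` (`-1.6703918716… + 9U/64`); NO claim node):
`M(U) = 0.1129173318 − 9U/64`, `M(4/5) ≥ 0.0004173318` (zero at `U ≈ 0.8030`).
[cite: EmeryKivelsonLin1990, pp. 475–476] [cite: Israel1979, Thm. I.2.4] [cite: BachLiebSolovej1994, eq. (2c.36)] [cite: LiebLoss1993, §8, Theorem 8.2] -/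
theorem psTW_half_one_tpp1o5_not_groundState_mix {U : ℝ} (hU : U ∈ Set.Icc (0 : ℝ) (4 / 5 : ℝ))
    {ω₁ ω₃ : InfVolFermionState 2} (h₁ : ω₁.IsTranslationInvariant) (h₃ : ω₃.IsTranslationInvariant)
    (hρ₁ : 0 < ω₁.density) (hρ₁' : ω₁.density ≤ (1 / 2)) (hρ₃ : 1 ≤ ω₃.density) (hρ₃' : ω₃.density < 2)
    {lam : ℝ} (hl0 : 0 < lam) (hl1 : lam < 1) :
    energyDensityTT' 1 (1 / 5) U (InfVolFermionState.mix lam hl0.le hl1.le ω₁ ω₃).density <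
      (InfVolFermionState.mix lam hl0.le hl1.le ω₁ ω₃).meanEnergy (hubbardTTPrimeFermionInteraction 1 (1 / 5) U) 1 := by
  obtain ⟨hlo, hhi⟩ := hU
  have hU0 : (0 : ℝ) ≤ U := hlo
  have k12tpp1o5 : ((-735672127/500000000 : ℚ) : ℝ) ≤ energyDensityTT' 1 (1 / 5) U (1 / 2) := by
    have h0 := fermiSeaCellRow_tPrime_one_div_five_density_one_div_two (U := U) hU0
    have e0 : ((-735672127/500000000 : ℚ) : ℝ) = (-1.4713442540 : ℝ) := by norm_num
    rw [e0]; norm_num at h0 ⊢; linarith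
  have k1tpp1o5 : ((-3287209651/2000000000 : ℚ) : ℝ) ≤ energyDensityTT' 1 (1 / 5) U 1 := by
    have h0 := fermiSeaCellRow_tPrime_neg_one_div_five_density_one (U := U) hU0
    have he := energyDensityTT'_particleHole_one 1 (-1 / 5 : ℝ) hU0
    rw [show (-(-1 / 5 : ℝ)) = 1 / 5 by norm_num] at he
    have e0 : ((-3287209651/2000000000 : ℚ) : ℝ) = (-1.6436048255 : ℝ) := by norm_num
    rw [he, e0]; norm_num at h0 ⊢; linarith
  have kcap : energyDensityTT' 1 (1 / 5) U (3 / 4) ≤ ((-4175979679/2500000000 : ℚ) : ℝ) + U * ((3 / 4 : ℝ) / 2) ^ 2 := hfCap_tpp1o5_n3o4 (U := U) hU0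
  refine psT_thresholds_of_cap_lt' (1 / 5) hU0 (n₁ := (1 / 2)) (n₃ := 1) (a := (1 / 2)) (b := (1 / 2))
    (by norm_num) (by norm_num) (by norm_num) (by norm_num) (by norm_num) kcap k12tpp1o5 k1tpp1o5 ?_ h₁ h₃ hρ₁ hρ₁' hρ₃ hρ₃' hl0 hl1
  push_cast
  nlinarith [hlo, hhi]

/-! ## §2 ELECTRON side `(1 | 3/2)` at `t′ ∈ {−3/10, −1/4, −1/5}` (premise-free; PH images of §1) -/

/-- **ELECTRON side: `(1 | 3/2)` excluded at `t′ = -3/10` for every `U ∈ [0, 17/20]`** (`t = 1`; PREMISE-FREE; particle–hole image of the hole-side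
triple `(1/2, 3/4, 1)` at `t′ = +3/10` — same kernel floors / Hartree–Fock cap, same margin `M(17/20) ≥ 0.0030913756`): no translation-invariant ground
state of the `t–t′–U` model at `t′ = -3/10` and coupling `U`, at any density, is a macroscopic mixture of translation-invariant states of densities
`0 < ρ(ω₁) ≤ 1` and `3/2 ≤ ρ(ω₃) < 2`. [cite: EmeryKivelsonLin1990, pp. 475–476] [cite: Israel1979, Thm. I.2.4] [cite: LiebWuPhysicaA2003, §1 eq. (3)] [cite: BachLiebSolovej1994, eq. (2c.36)] -/
theorem psTWE_one_3o2_tpm3o10_not_groundState_mix {U : ℝ} (hU : U ∈ Set.Icc (0 : ℝ) (17 / 20 : ℝ))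
    {ω₁ ω₃ : InfVolFermionState 2} (h₁ : ω₁.IsTranslationInvariant) (h₃ : ω₃.IsTranslationInvariant)
    (hρ₁ : 0 < ω₁.density) (hρ₁' : ω₁.density ≤ 1) (hρ₃ : (3 / 2) ≤ ω₃.density) (hρ₃' : ω₃.density < 2)
    {lam : ℝ} (hl0 : 0 < lam) (hl1 : lam < 1) :
    energyDensityTT' 1 (-3 / 10) U (InfVolFermionState.mix lam hl0.le hl1.le ω₁ ω₃).density <
      (InfVolFermionState.mix lam hl0.le hl1.le ω₁ ω₃).meanEnergy (hubbardTTPrimeFermionInteraction 1 (-3 / 10) U) 1 := by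
  obtain ⟨hlo, hhi⟩ := hU
  have hU0 : (0 : ℝ) ≤ U := hlo
  have k12tpp3o10 : ((-15505264679/10000000000 : ℚ) : ℝ) ≤ energyDensityTT' 1 (3 / 10) U (1 / 2) := by
    have h0 := fermiSeaCellRow_tPrime_three_div_ten_density_one_div_two (U := U) hU0
    have e0 : ((-15505264679/10000000000 : ℚ) : ℝ) = (-1.5505264679 : ℝ) := by norm_num
    rw [e0]; norm_num at h0 ⊢; linarith
  have k1tpp3o10 : ((-4161662799/2500000000 : ℚ) : ℝ) ≤ energyDensityTT' 1 (3 / 10) U 1 := by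
    have h0 := fermiSeaCellRow_tPrime_neg_three_div_ten_density_one (U := U) hU0
    have he := energyDensityTT'_particleHole_one 1 (-3 / 10 : ℝ) hU0
    rw [show (-(-3 / 10 : ℝ)) = 3 / 10 by norm_num] at he
    have e0 : ((-4161662799/2500000000 : ℚ) : ℝ) = (-1.6646651196 : ℝ) := by norm_num
    rw [he, e0]; norm_num at h0 ⊢; linarith
  have kcap : energyDensityTT' 1 (3 / 10) U (3 / 4) ≤ ((-8651092097/5000000000 : ℚ) : ℝ) + U * ((3 / 4 : ℝ) / 2) ^ 2 := hfCap_tpp3o10_n3o4 (U := U) hU0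
  refine psT_thresholds_mirror_not_groundState_mix_of_cap_lt (3 / 10) (-3 / 10) (by norm_num) hU0 (n₁ := (1 / 2)) (n₃ := 1) (p := 1) (q := (3 / 2))
    (a := (1 / 2)) (b := (1 / 2)) (by norm_num) (by norm_num) (by norm_num) (by norm_num) (by norm_num) (by norm_num) (by norm_num)
    (by norm_num) (by norm_num) kcap k12tpp3o10 k1tpp3o10 ?_ h₁ h₃ hρ₁ hρ₁' hρ₃ hρ₃' hl0 hl1
  push_cast
  nlinarith [hlo, hhi]

/-- **ELECTRON side: `(1 | 3/2)` excluded at `t′ = -1/4` for every `U ∈ [0, 4/5]`** (`t = 1`; PREMISE-FREE; particle–hole image of the hole-side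
triple `(1/2, 3/4, 1)` at `t′ = +1/4` — same kernel floors / Hartree–Fock cap, same margin `M(4/5) ≥ 0.0053063336`): no translation-invariant ground
state of the `t–t′–U` model at `t′ = -1/4` and coupling `U`, at any density, is a macroscopic mixture of translation-invariant states of densities
`0 < ρ(ω₁) ≤ 1` and `3/2 ≤ ρ(ω₃) < 2`. [cite: EmeryKivelsonLin1990, pp. 475–476] [cite: Israel1979, Thm. I.2.4] [cite: LiebWuPhysicaA2003, §1 eq. (3)] [cite: BachLiebSolovej1994, eq. (2c.36)] -/
theorem psTWE_one_3o2_tpm1o4_not_groundState_mix {U : ℝ} (hU : U ∈ Set.Icc (0 : ℝ) (4 / 5 : ℝ))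
    {ω₁ ω₃ : InfVolFermionState 2} (h₁ : ω₁.IsTranslationInvariant) (h₃ : ω₃.IsTranslationInvariant)
    (hρ₁ : 0 < ω₁.density) (hρ₁' : ω₁.density ≤ 1) (hρ₃ : (3 / 2) ≤ ω₃.density) (hρ₃' : ω₃.density < 2)
    {lam : ℝ} (hl0 : 0 < lam) (hl1 : lam < 1) :
    energyDensityTT' 1 (-1 / 4) U (InfVolFermionState.mix lam hl0.le hl1.le ω₁ ω₃).density <
      (InfVolFermionState.mix lam hl0.le hl1.le ω₁ ω₃).meanEnergy (hubbardTTPrimeFermionInteraction 1 (-1 / 4) U) 1 := by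
  obtain ⟨hlo, hhi⟩ := hU
  have hU0 : (0 : ℝ) ≤ U := hlo
  have k12tpp1o4 : ((-3777207301/2500000000 : ℚ) : ℝ) ≤ energyDensityTT' 1 (1 / 4) U (1 / 2) := by
    have h0 := fermiSeaCellRow_tPrime_one_div_four_density_one_div_two (U := U) hU0
    have e0 : ((-3777207301/2500000000 : ℚ) : ℝ) = (-1.5108829204 : ℝ) := by norm_num
    rw [e0]; norm_num at h0 ⊢; linarith
  have k1tpp1o4 : ((-16534675871/10000000000 : ℚ) : ℝ) ≤ energyDensityTT' 1 (1 / 4) U 1 := by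
    have h0 := fermiSeaCellRow_tPrime_neg_one_div_four_density_one (U := U) hU0
    have he := energyDensityTT'_particleHole_one 1 (-1 / 4 : ℝ) hU0
    rw [show (-(-1 / 4 : ℝ)) = 1 / 4 by norm_num] at he
    have e0 : ((-16534675871/10000000000 : ℚ) : ℝ) = (-1.6534675871 : ℝ) := by norm_num
    rw [he, e0]; norm_num at h0 ⊢; linarith
  have kcap : energyDensityTT' 1 (1 / 4) U (3 / 4) ≤ ((-8499907937/5000000000 : ℚ) : ℝ) + U * ((3 / 4 : ℝ) / 2) ^ 2 := hfCap_tpp1o4_n3o4 (U := U) hU0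
  refine psT_thresholds_mirror_not_groundState_mix_of_cap_lt (1 / 4) (-1 / 4) (by norm_num) hU0 (n₁ := (1 / 2)) (n₃ := 1) (p := 1) (q := (3 / 2))
    (a := (1 / 2)) (b := (1 / 2)) (by norm_num) (by norm_num) (by norm_num) (by norm_num) (by norm_num) (by norm_num) (by norm_num)
    (by norm_num) (by norm_num) kcap k12tpp1o4 k1tpp1o4 ?_ h₁ h₃ hρ₁ hρ₁' hρ₃ hρ₃' hl0 hl1
  push_cast
  nlinarith [hlo, hhi]

/-- **ELECTRON side: `(1 | 3/2)` excluded at `t′ = -1/5` for every `U ∈ [0, 4/5]`** (`t = 1`; PREMISE-FREE; particle–hole image of the hole-side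
triple `(1/2, 3/4, 1)` at `t′ = +1/5` — same kernel floors / Hartree–Fock cap, same margin `M(4/5) ≥ 0.0004173318`): no translation-invariant ground
state of the `t–t′–U` model at `t′ = -1/5` and coupling `U`, at any density, is a macroscopic mixture of translation-invariant states of densities
`0 < ρ(ω₁) ≤ 1` and `3/2 ≤ ρ(ω₃) < 2`. [cite: EmeryKivelsonLin1990, pp. 475–476] [cite: Israel1979, Thm. I.2.4] [cite: LiebWuPhysicaA2003, §1 eq. (3)] [cite: BachLiebSolovej1994, eq. (2c.36)] -/
theorem psTWE_one_3o2_tpm1o5_not_groundState_mix {U : ℝ} (hU : U ∈ Set.Icc (0 : ℝ) (4 / 5 : ℝ))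
    {ω₁ ω₃ : InfVolFermionState 2} (h₁ : ω₁.IsTranslationInvariant) (h₃ : ω₃.IsTranslationInvariant)
    (hρ₁ : 0 < ω₁.density) (hρ₁' : ω₁.density ≤ 1) (hρ₃ : (3 / 2) ≤ ω₃.density) (hρ₃' : ω₃.density < 2)
    {lam : ℝ} (hl0 : 0 < lam) (hl1 : lam < 1) :
    energyDensityTT' 1 (-1 / 5) U (InfVolFermionState.mix lam hl0.le hl1.le ω₁ ω₃).density <
      (InfVolFermionState.mix lam hl0.le hl1.le ω₁ ω₃).meanEnergy (hubbardTTPrimeFermionInteraction 1 (-1 / 5) U) 1 := by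
  obtain ⟨hlo, hhi⟩ := hU
  have hU0 : (0 : ℝ) ≤ U := hlo
  have k12tpp1o5 : ((-735672127/500000000 : ℚ) : ℝ) ≤ energyDensityTT' 1 (1 / 5) U (1 / 2) := by
    have h0 := fermiSeaCellRow_tPrime_one_div_five_density_one_div_two (U := U) hU0
    have e0 : ((-735672127/500000000 : ℚ) : ℝ) = (-1.4713442540 : ℝ) := by norm_num
    rw [e0]; norm_num at h0 ⊢; linarith
  have k1tpp1o5 : ((-3287209651/2000000000 : ℚ) : ℝ) ≤ energyDensityTT' 1 (1 / 5) U 1 := by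
    have h0 := fermiSeaCellRow_tPrime_neg_one_div_five_density_one (U := U) hU0
    have he := energyDensityTT'_particleHole_one 1 (-1 / 5 : ℝ) hU0
    rw [show (-(-1 / 5 : ℝ)) = 1 / 5 by norm_num] at he
    have e0 : ((-3287209651/2000000000 : ℚ) : ℝ) = (-1.6436048255 : ℝ) := by norm_num
    rw [he, e0]; norm_num at h0 ⊢; linarith
  have kcap : energyDensityTT' 1 (1 / 5) U (3 / 4) ≤ ((-4175979679/2500000000 : ℚ) : ℝ) + U * ((3 / 4 : ℝ) / 2) ^ 2 := hfCap_tpp1o5_n3o4 (U := U) hU0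
  refine psT_thresholds_mirror_not_groundState_mix_of_cap_lt (1 / 5) (-1 / 5) (by norm_num) hU0 (n₁ := (1 / 2)) (n₃ := 1) (p := 1) (q := (3 / 2))
    (a := (1 / 2)) (b := (1 / 2)) (by norm_num) (by norm_num) (by norm_num) (by norm_num) (by norm_num) (by norm_num) (by norm_num)
    (by norm_num) (by norm_num) kcap k12tpp1o5 k1tpp1o5 ?_ h₁ h₃ hρ₁ hρ₁' hρ₃ hρ₃' hl0 hl1
  push_cast
  nlinarith [hlo, hhi]

/-! ## §3 ELECTRON side on the cell `t′ ∈ [−3/10, −1/5] × U ∈ [0, 39/50]` (premise-free; hole-side mirror cell `[1/5, 3/10]`) -/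

/-- **ELECTRON side: `(1 | 3/2)` excluded on the CELL `t′ ∈ [−3/10, −1/5] × U ∈ [0, 39/50]`** (`t = 1`; PREMISE-FREE; particle–hole image of the hole-side
triple `(1/2, 3/4, 1)` on the mirror cell `t′ ∈ [1/5, 3/10]`: floors = `t′`-CHORDS of the kernel Fermi-sea point rows at `t′ = 1/5`, `3/10` (`n = 1/2` NEW rows;
`n = 1` by evenness from the `t′ < 0` rows), cap = the affine kernel Hartree–Fock row `hfCapAff_tpp1o5_p3o10_n3o4`; NO claim node): for every `(t′, U)` of the cell,
no translation-invariant ground state of the `t–t′–U` model, at any density, is a macroscopic mixture of translation-invariant states of densities `0 < ρ(ω₁) ≤ 1` and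
`3/2 ≤ ρ(ω₃) < 2`; margin affine in `(t′, U)`: `0.1221463642` @ `(−3/10, 0)`, `0.1127464762` @ `(−1/5, 0)`, `≥ 0.0030589762` at `U = 39/50`.
[cite: EmeryKivelsonLin1990, pp. 475–476] [cite: Israel1979, Thm. I.2.4] [cite: LiebWuPhysicaA2003, §1 eq. (3)] [cite: BachLiebSolovej1994, eq. (2c.36)] [cite: Ruelle1969, §3.3] -/
theorem psTWE_one_3o2_cell_m3o10_m1o5_not_groundState_mix {s : ℝ} (hs : s ∈ Set.Icc (-3 / 10 : ℝ) (-1 / 5)) {U : ℝ} (hU : U ∈ Set.Icc (0 : ℝ) (39 / 50 : ℝ))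
    {ω₁ ω₃ : InfVolFermionState 2} (h₁ : ω₁.IsTranslationInvariant) (h₃ : ω₃.IsTranslationInvariant)
    (hρ₁ : 0 < ω₁.density) (hρ₁' : ω₁.density ≤ 1) (hρ₃ : (3 / 2) ≤ ω₃.density) (hρ₃' : ω₃.density < 2)
    {lam : ℝ} (hl0 : 0 < lam) (hl1 : lam < 1) :
    energyDensityTT' 1 (s) U (InfVolFermionState.mix lam hl0.le hl1.le ω₁ ω₃).density <
      (InfVolFermionState.mix lam hl0.le hl1.le ω₁ ω₃).meanEnergy (hubbardTTPrimeFermionInteraction 1 (s) U) 1 := by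
  obtain ⟨hlo, hhi⟩ := hU
  obtain ⟨hs1, hs2⟩ := hs
  have hU0 : (0 : ℝ) ≤ U := hlo
  have k12tpp1o5 : ((-735672127/500000000 : ℚ) : ℝ) ≤ energyDensityTT' 1 (1 / 5) U (1 / 2) := by
    have h0 := fermiSeaCellRow_tPrime_one_div_five_density_one_div_two (U := U) hU0
    have e0 : ((-735672127/500000000 : ℚ) : ℝ) = (-1.4713442540 : ℝ) := by norm_num
    rw [e0]; norm_num at h0 ⊢; linarith
  have k1tpp1o5 : ((-3287209651/2000000000 : ℚ) : ℝ) ≤ energyDensityTT' 1 (1 / 5) U 1 := by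
    have h0 := fermiSeaCellRow_tPrime_neg_one_div_five_density_one (U := U) hU0
    have he := energyDensityTT'_particleHole_one 1 (-1 / 5 : ℝ) hU0
    rw [show (-(-1 / 5 : ℝ)) = 1 / 5 by norm_num] at he
    have e0 : ((-3287209651/2000000000 : ℚ) : ℝ) = (-1.6436048255 : ℝ) := by norm_num
    rw [he, e0]; norm_num at h0 ⊢; linarith
  have k12tpp3o10 : ((-15505264679/10000000000 : ℚ) : ℝ) ≤ energyDensityTT' 1 (3 / 10) U (1 / 2) := by
    have h0 := fermiSeaCellRow_tPrime_three_div_ten_density_one_div_two (U := U) hU0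
    have e0 : ((-15505264679/10000000000 : ℚ) : ℝ) = (-1.5505264679 : ℝ) := by norm_num
    rw [e0]; norm_num at h0 ⊢; linarith
  have k1tpp3o10 : ((-4161662799/2500000000 : ℚ) : ℝ) ≤ energyDensityTT' 1 (3 / 10) U 1 := by
    have h0 := fermiSeaCellRow_tPrime_neg_three_div_ten_density_one (U := U) hU0
    have he := energyDensityTT'_particleHole_one 1 (-3 / 10 : ℝ) hU0
    rw [show (-(-3 / 10 : ℝ)) = 3 / 10 by norm_num] at he
    have e0 : ((-4161662799/2500000000 : ℚ) : ℝ) = (-1.6646651196 : ℝ) := by norm_num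
    rw [he, e0]; norm_num at h0 ⊢; linarith
  have hf₁ := energyDensityTT'_tchord_floor_of_mem_Icc 1 hU0 (n := (1 / 2)) (by norm_num) (by norm_num) (s₁ := 1 / 5) (s₂ := 3 / 10)
    (by norm_num) k12tpp1o5 k12tpp3o10 (s := -s) ⟨by linarith, by linarith⟩
  have hf₃ := energyDensityTT'_tchord_floor_of_mem_Icc 1 hU0 (n := 1) (by norm_num) (by norm_num) (s₁ := 1 / 5) (s₂ := 3 / 10)
    (by norm_num) k1tpp1o5 k1tpp3o10 (s := -s) ⟨by linarith, by linarith⟩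
  have kcap := hfCapAff_tpp1o5_p3o10_n3o4 (s := -s) ⟨by linarith, by linarith⟩ hU0
  have hd : ((3 / 10 : ℝ) - 1 / 5) = 1 / 10 := by norm_num
  rw [hd] at hf₁ hf₃
  refine psT_thresholds_mirror_not_groundState_mix_of_cap_lt (-s) s (by ring) hU0 (n₁ := (1 / 2)) (n₃ := 1) (p := 1) (q := (3 / 2))
    (a := (1 / 2)) (b := (1 / 2)) (by norm_num) (by norm_num) (by norm_num) (by norm_num) (by norm_num) (by norm_num) (by norm_num)
    (by norm_num) (by norm_num) kcap hf₁ hf₃ ?_ h₁ h₃ hρ₁ hρ₁' hρ₃ hρ₃' hl0 hl1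
  push_cast
  nlinarith [hlo, hhi, hs1, hs2]

/-! ## Prints -/

/-- **prints** (decidable, `norm_num`): far-end margins of the three mirror columns and the two `U = 39/50` cell corners (exact rationals, all `> 0`). -/
theorem psTWE_margins_pos :
    (0 : ℚ) < 61827513/20000000000 ∧
    (0 : ℚ) < 106126673/20000000000 ∧
    (0 : ℚ) < 8346637/20000000000 ∧
    (0 : ℚ) < 2447181/800000000 ∧
    (0 : ℚ) < 49835457/4000000000 := by norm_num

end Summit.Ventures.CertifiedManyBodySolver.Observables

end
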